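import Summits.HubbardSuperconductivity.HubbardSuperconductivity.Theses.AposterioriCapRg
import Literature.MathematicalPhysics.QuantumLattice.PairCorrelationsD4Proofs
import Literature.MathematicalPhysics.QuantumLattice.PairCorrelationsB1gCharProofs
import Literature.MathematicalPhysics.QuantumLattice.RayleighBottom

/-!
# Line `strict-continuum-certificate-transfer` for crux `CapRgSymmetricCertificatePinned`
# (item stmt-HubbardSuperconductivity-14045, route AposterioriCapRg) — stub `stub_dominanceOfMargins`

The open-condition form of `CooperDominance` (clause (ii′) of the symmetric-regime certificate): for a
`D₄`-covariant matrix `A` on the torus momenta, a STRICT gap between the `B₁g` bottom of the Rayleigh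
quotient `q(v) = Re⟨v, A v⟩` and its bottom on the orthogonal complement of the `B₁g` functions, a
negative global bottom `-λ_d = -(-A).supRayleigh`, and a second Rayleigh level (Courant–Fischer max–min)
at least `-λ_d / 2` together give `CooperDominance A`.

Proof (finite-dimensional, elementary; no spectral theorem).  The general Rayleigh-quotient
bookkeeping (entry bound, compactness and attainment of the bottom, its identification with
`-(-A).supRayleigh`, the first variation `⟨f, A g⟩ + conj ⟨g, A f⟩ = 0` at a global minimiser `f` for
`g ⊥ f`, and the two-dimensional Courant–Fischer step) is the Literature file
`QuantumLattice/RayleighBottom.lean`; here: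
* §1 the `B₁g` isotypic decomposition `v = P v + (v - P v)` with `P = (1/8) Σ_γ χ_{B₁g}(γ) γ^*`
  (`exists_isB1g_add_orth`, from `d4Site_mul_holds`, `b1gChar_mul_holds`), and orthogonal additivity
  `q(w + w') = q(w) + q(w')` across it for a covariant `A` (`reRayleigh_add_of_isB1g_of_orth`: `A` and
  `Aᴴ` map `B₁g` functions to `B₁g` functions);
* §2 assembly: a global minimiser has no component orthogonal to `B₁g` (strict gap + negative
  bottom; the `⨅` over an empty `B₁g` unit set is the junk `0`, excluded by the negative bottom), hence
  is `B₁g`; for a unit `g ⊥ f` and every unit `f'` the plane `span{f, g}` meets `f'ᗮ` in a unit vector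
  with quotient `≤ q(g)`, so the max–min level, hence `-λ_d / 2`, is `≤ q(g)`.
Sources: folklore (Rayleigh quotients, isotypic projections; Scalapino 1995 §2 for `D₄`, `B₁g`).
-/

noncomputable section

namespace Summit.HubbardSuperconductivity.CapRgSymmetricCertificatePinned.StrictContinuum

open Literature.MathematicalPhysics.QuantumLattice Literature.Probability.LatticeModels Matrix
open Literature.MathematicalPhysics.QuantumLattice.RayleighBottom
open scoped BigOperators ComplexConjugate ComplexOrder

/-! ## §1 The `B₁g` isotypic decomposition on the torus -/

section D4

variable {L : ℕ} [NeZero L]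

/-- `χ_{B₁g}` is real: `conj χ(γ) = χ(γ)`. [folklore] -/
theorem star_b1gChar (γ : DihedralGroup 4) : star (b1gChar γ) = b1gChar γ := by
  cases γ <;> simp [b1gChar]

/-- `χ_{B₁g}(γ)² = 1`. [folklore] -/
theorem b1gChar_mul_self' (γ : DihedralGroup 4) : b1gChar γ * b1gChar γ = 1 := by
  cases γ <;> simp [b1gChar, ← pow_add, ← two_mul, pow_mul]

/-- Reindexing a sum over the torus along the bijection `d4Site γ` (inverse `d4Site γ⁻¹`, from
`d4Site_mul_holds`). [folklore] -/
theorem sum_comp_d4Site (γ : DihedralGroup 4) (F : TorusSite 2 L → ℂ) :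
    ∑ k, F (d4Site γ k) = ∑ k, F k :=
  Equiv.sum_comp
    ⟨d4Site γ, d4Site γ⁻¹,
      fun x => by rw [← (d4Site_mul_holds γ⁻¹ γ x : d4Site (γ⁻¹ * γ) x = _), inv_mul_cancel, d4Site_one],
      fun x => by rw [← (d4Site_mul_holds γ γ⁻¹ x : d4Site (γ * γ⁻¹) x = _), mul_inv_cancel, d4Site_one]⟩
    F

/-- A `D₄`-covariant matrix maps `B₁g` functions to `B₁g` functions. [folklore] -/
theorem isB1g_mulVec {A : Matrix (TorusSite 2 L) (TorusSite 2 L) ℂ}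
    (hcov : ∀ (γ : DihedralGroup 4) (k k' : TorusSite 2 L), A (d4Site γ k) (d4Site γ k') = A k k')
    {w : TorusSite 2 L → ℂ} (hw : IsB1g w) : IsB1g (A *ᵥ w) := by
  intro γ k
  simp only [Matrix.mulVec, dotProduct]
  rw [← sum_comp_d4Site γ (fun j => A (d4Site γ k) j * w j), Finset.mul_sum]
  refine Finset.sum_congr rfl fun j _ => ?_
  rw [hcov, hw γ j]
  ring

omit [NeZero L] in
/-- The conjugate transpose of a `D₄`-covariant matrix is `D₄`-covariant. [folklore] -/
theorem conjTranspose_cov {A : Matrix (TorusSite 2 L) (TorusSite 2 L) ℂ}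
    (hcov : ∀ (γ : DihedralGroup 4) (k k' : TorusSite 2 L), A (d4Site γ k) (d4Site γ k') = A k k')
    (γ : DihedralGroup 4) (k k' : TorusSite 2 L) : Aᴴ (d4Site γ k) (d4Site γ k') = Aᴴ k k' := by
  simp only [Matrix.conjTranspose_apply, hcov]

/-- **Orthogonal additivity** of the Rayleigh quotient of a covariant matrix across
`B₁g ⊕ B₁gᗮ`: `q(w + w') = q(w) + q(w')`. [folklore] -/
theorem reRayleigh_add_of_isB1g_of_orth {A : Matrix (TorusSite 2 L) (TorusSite 2 L) ℂ}
    (hcov : ∀ (γ : DihedralGroup 4) (k k' : TorusSite 2 L), A (d4Site γ k) (d4Site γ k') = A k k')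
    {w w' : TorusSite 2 L → ℂ} (hw : IsB1g w)
    (hw' : ∀ f : TorusSite 2 L → ℂ, IsB1g f → star f ⬝ᵥ w' = 0) :
    reRayleigh A (w + w') = reRayleigh A w + reRayleigh A w' := by
  rw [reRayleigh_add]
  have h1 : star w ⬝ᵥ (A *ᵥ w') = 0 := by
    rw [star_dotProduct_mulVec_eq]
    exact hw' _ (isB1g_mulVec (conjTranspose_cov hcov) hw)
  have h2 : star w' ⬝ᵥ (A *ᵥ w) = 0 := by
    rw [star_dotProduct, hw' _ (isB1g_mulVec hcov hw), star_zero]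
  rw [h1, h2, add_zero, Complex.zero_re, add_zero]

/-- **Isotypic decomposition**: every function on the torus is a `B₁g` function plus a function
orthogonal to all `B₁g` functions (`v = P v + (v - P v)`, `P = (1/8) Σ_γ χ_{B₁g}(γ) γ^*`). [folklore] -/
theorem exists_isB1g_add_orth (v : TorusSite 2 L → ℂ) :
    ∃ w w' : TorusSite 2 L → ℂ, v = w + w' ∧ IsB1g w ∧
      ∀ f : TorusSite 2 L → ℂ, IsB1g f → star f ⬝ᵥ w' = 0 := by
  let P : TorusSite 2 L → ℂ := fun k => ∑ γ : DihedralGroup 4, (8 : ℂ)⁻¹ * (b1gChar γ * v (d4Site γ k))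
  have h8 : (Finset.univ : Finset (DihedralGroup 4)).card = 8 := by
    simp [Finset.card_univ, DihedralGroup.card]
  refine ⟨P, v - P, (add_sub_cancel P v).symm, ?_, ?_⟩
  · intro γ₀ k
    show (∑ γ : DihedralGroup 4, (8 : ℂ)⁻¹ * (b1gChar γ * v (d4Site γ (d4Site γ₀ k)))) =
      b1gChar γ₀ * ∑ γ : DihedralGroup 4, (8 : ℂ)⁻¹ * (b1gChar γ * v (d4Site γ k))
    rw [Finset.mul_sum,
      ← Equiv.sum_comp (Equiv.mulRight γ₀) (fun γ => b1gChar γ₀ * ((8 : ℂ)⁻¹ * (b1gChar γ * v (d4Site γ k))))]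
    refine Finset.sum_congr rfl fun γ _ => ?_
    simp only [Equiv.coe_mulRight]
    rw [(d4Site_mul_holds γ γ₀ k : d4Site (γ * γ₀) k = _), b1gChar_mul_holds γ γ₀]
    linear_combination ((8 : ℂ)⁻¹ * b1gChar γ * v (d4Site γ (d4Site γ₀ k))) * (b1gChar_mul_self' γ₀).symm
  · intro f hf
    rw [dotProduct_sub, sub_eq_zero]
    calc star f ⬝ᵥ v = ∑ γ : DihedralGroup 4, (8 : ℂ)⁻¹ * (star f ⬝ᵥ v) := by
          rw [Finset.sum_const, h8, nsmul_eq_mul]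
          push_cast
          ring
      _ = ∑ γ : DihedralGroup 4, ∑ k, star f k * ((8 : ℂ)⁻¹ * (b1gChar γ * v (d4Site γ k))) := by
          refine Finset.sum_congr rfl fun γ _ => ?_
          rw [dotProduct, Finset.mul_sum, ← sum_comp_d4Site γ (fun k => (8 : ℂ)⁻¹ * (star f k * v k))]
          refine Finset.sum_congr rfl fun k _ => ?_
          simp only [Pi.star_apply]
          rw [hf γ k, star_mul', star_b1gChar]
          ring
      _ = star f ⬝ᵥ P := by
          rw [dotProduct, Finset.sum_comm]
          exact Finset.sum_congr rfl fun k _ => (Finset.mul_sum _ _ _).symm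

end D4

/-! ## §2 The stub -/

/-- **Stub `stub_dominanceOfMargins`** (open-condition form of `CooperDominance`): for a `D₄`-covariant
matrix, a STRICT gap between the `B₁g` bottom and the bottom on the orthogonal complement of the `B₁g`
functions, a negative bottom, and a second-lowest Rayleigh level `≥` half the bottom give
`CooperDominance` (bottom attained on a `B₁g` unit vector, everything orthogonal `≥ -λ_d/2`). [folklore] -/
theorem stub_dominanceOfMargins : ∀ (L : ℕ) [NeZero L] (A : Matrix (TorusSite 2 L) (TorusSite 2 L) ℂ),
    (∀ (γ : DihedralGroup 4) (k k' : TorusSite 2 L), A (d4Site γ k) (d4Site γ k') = A k k') →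
    (⨅ f : {f : TorusSite 2 L → ℂ // star f ⬝ᵥ f = 1 ∧ IsB1g f}, reRayleigh A f.1) <
      ⨅ g : {g : TorusSite 2 L → ℂ // star g ⬝ᵥ g = 1 ∧ ∀ f : TorusSite 2 L → ℂ, IsB1g f → star f ⬝ᵥ g = 0},
        reRayleigh A g.1 →
    -(-A).supRayleigh < 0 →
    -(-A).supRayleigh / 2 ≤ ⨆ f : {f : TorusSite 2 L → ℂ // star f ⬝ᵥ f = 1},
      ⨅ g : {g : TorusSite 2 L → ℂ // star g ⬝ᵥ g = 1 ∧ star f.1 ⬝ᵥ g = 0}, reRayleigh A g.1 →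
    CooperDominance A := by
  intro L _ A hcov h1 h2 h3
  have hbddW : BddBelow (Set.range fun g : {g : TorusSite 2 L → ℂ // star g ⬝ᵥ g = 1 ∧
      ∀ f : TorusSite 2 L → ℂ, IsB1g f → star f ⬝ᵥ g = 0} => reRayleigh A g.1) :=
    ⟨-(∑ i, ∑ j, ‖A i j‖), by
      rintro _ ⟨g, rfl⟩
      exact neg_entry_sum_le_reRayleigh A g.2.1⟩
  have hbddO : ∀ f' : TorusSite 2 L → ℂ, BddBelow (Set.range
      fun g : {g : TorusSite 2 L → ℂ // star g ⬝ᵥ g = 1 ∧ star f' ⬝ᵥ g = 0} => reRayleigh A g.1) :=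
    fun f' => ⟨-(∑ i, ∑ j, ‖A i j‖), by
      rintro _ ⟨g, rfl⟩
      exact neg_entry_sum_le_reRayleigh A g.2.1⟩
  -- Step 1: the bottom is attained
  obtain ⟨f, hf, hmin⟩ := exists_min_reRayleigh A
  have hfq : reRayleigh A f = -(-A).supRayleigh := reRayleigh_eq_of_min A hf hmin
  -- Step 2: the minimiser is `B₁g` (strict isotypic gap)
  obtain ⟨w, w', hfw, hw, hw'⟩ := exists_isB1g_add_orth f
  have hw'0 : w' = 0 := by
    by_contra hne
    have hpos : 0 < (star w' ⬝ᵥ w').re := re_star_dotProduct_self_pos hne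
    obtain ⟨c, hc1, hc2⟩ := exists_smul_unit hpos
    have hcw' : ∀ g : TorusSite 2 L → ℂ, IsB1g g → star g ⬝ᵥ (c • w') = 0 := fun g hg => by
      rw [dotProduct_smul, hw' g hg, smul_zero]
    have hmperp : (⨅ g : {g : TorusSite 2 L → ℂ // star g ⬝ᵥ g = 1 ∧
        ∀ f : TorusSite 2 L → ℂ, IsB1g f → star f ⬝ᵥ g = 0}, reRayleigh A g.1) ≤
        ‖c‖ ^ 2 * reRayleigh A w' := by
      rw [← reRayleigh_smul]
      exact ciInf_le hbddW ⟨c • w', hc1, hcw'⟩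
    have hmW : -(-A).supRayleigh ≤
        ⨅ f : {f : TorusSite 2 L → ℂ // star f ⬝ᵥ f = 1 ∧ IsB1g f}, reRayleigh A f.1 := by
      rcases isEmpty_or_nonempty {f : TorusSite 2 L → ℂ // star f ⬝ᵥ f = 1 ∧ IsB1g f} with he | hne'
      · rw [Real.iInf_of_isEmpty]
        exact h2.le
      · exact le_ciInf fun g => neg_supRayleigh_neg_le A g.2.1
    have hlt : -(-A).supRayleigh * (star w' ⬝ᵥ w').re < reRayleigh A w' := by
      have h := (hmW.trans_lt h1).trans_le hmperp
      calc -(-A).supRayleigh * (star w' ⬝ᵥ w').re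
          < ‖c‖ ^ 2 * reRayleigh A w' * (star w' ⬝ᵥ w').re := mul_lt_mul_of_pos_right h hpos
        _ = ‖c‖ ^ 2 * (star w' ⬝ᵥ w').re * reRayleigh A w' := by ring
        _ = reRayleigh A w' := by rw [hc2, one_mul]
    have hwle : -(-A).supRayleigh * (star w ⬝ᵥ w).re ≤ reRayleigh A w := bottom_mul_le_reRayleigh A w
    have hww' : star w ⬝ᵥ w' = 0 := hw' w hw
    have hN : (star w ⬝ᵥ w).re + (star w' ⬝ᵥ w').re = 1 := by
      have h := congrArg Complex.re hf
      have hexp := star_lincomb_dotProduct 1 1 w w'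
      rw [one_smul, one_smul] at hexp
      rw [hfw, hexp, hww', star_dotProduct w' w, hww', star_zero] at h
      simpa using h
    have hq : reRayleigh A f = reRayleigh A w + reRayleigh A w' := by
      rw [hfw]
      exact reRayleigh_add_of_isB1g_of_orth hcov hw hw'
    have : -(-A).supRayleigh < -(-A).supRayleigh :=
      calc -(-A).supRayleigh
          = -(-A).supRayleigh * ((star w ⬝ᵥ w).re + (star w' ⬝ᵥ w').re) := by rw [hN, mul_one]
        _ < reRayleigh A w + reRayleigh A w' := by
          rw [mul_add]
          exact add_lt_add_of_le_of_lt hwle hlt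
        _ = -(-A).supRayleigh := by rw [← hq, hfq]
    exact lt_irrefl _ this
  have hfB : IsB1g f := by
    rw [hfw, hw'0, add_zero]
    exact hw
  -- Step 3: the orthogonal complement of `f` is bounded below by the max–min level
  refine ⟨f, hf, hfB, hfq, fun g hg hfg => ?_⟩
  have hmargin : ((symmetricCooperMargin : ℚ) : ℝ) = 2 := by norm_num [symmetricCooperMargin]
  rw [hmargin]
  refine h3.trans ?_
  haveI : Nonempty {f : TorusSite 2 L → ℂ // star f ⬝ᵥ f = 1} := ⟨⟨f, hf⟩⟩
  refine ciSup_le fun f' => ?_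
  obtain ⟨u, hu, hu', hle'⟩ :=
    exists_unit_orth_le A hf hg hfg (cross_eq_zero_of_min A hf hmin hfg) (hmin g hg) f'.1
  exact (ciInf_le (hbddO f'.1) ⟨u, hu, hu'⟩).trans hle'

end Summit.HubbardSuperconductivity.CapRgSymmetricCertificatePinned.StrictContinuum

end
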